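import Summits.Ventures.HodgeRepro2.T5InertPlaceGlobalPackage
import Summits.Ventures.HodgeRepro2.T5InertPrimeToy

/-!
# T5InertToyHeckeCommutative — the inert-place package end to end on a concrete instance:
`ℚ(i)_{(3)} / ℚ_3`, the unitary group of the identity form, EVERY hypothesis discharged

Tier-5 kernel support (N3) — p8, gen 15.  §8(d): uses an L-value-free non-vanishing device: NO.

Joint consistency of the hypotheses of `T5InertPlaceGlobalPackage` (README §10.5 (ii)(d)): with
`(K, L, v, w) = (ℚ, ℚ(ζ₄), (3), (3))` of `T5InertPrimeToy`, the uniformiser `3` of `ℚ_3`, any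
non-trivial automorphism `σ` of `L_{(3)} / ℚ_3` (one exists) and the Gram matrix `H = 1`
(σ-hermitian, unit determinant, integral entries and inverse):
* `exists_isotropic_one` — the identity form on `L_{(3)}³` has a non-zero isotropic vector;
* `heckeAlgebra_mul_comm_one` — the spherical Hecke algebra of the unitary group of the identity
  form over `ℚ(i)_{(3)}` with respect to its integral points is commutative;
* `exists_dualLattice_eq_one` — `(L_{(3)}³, 1)` admits a self-dual `𝒪_{E_v}`-lattice
  (`det 1 = 1 = 1 · 3^{2·0}`).

Nothing here concerns the datum's own hermitian space.
-/

namespace Summit.Ventures.HodgeRepro2.T5InertToyHeckeCommutative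

open NumberField IsDedekindDomain HeightOneSpectrum

/-- `3` has `(3)`-adic valuation `exp(−1)`. -/
theorem intValuation_three_vThree : T5InertPrimeToy.vThree.intValuation 3 = WithZero.exp (-1) :=
  intValuation_singleton _ T5InertPrimeToy.prime_three_ringOfIntegers_rat.ne_zero rfl

/-- `3` is a uniformiser of `O_{ℚ_3}`. -/
theorem irreducible_three_vThree :
    Irreducible (algebraMap (𝓞 ℚ) (T5InertPrimeToy.vThree.adicCompletionIntegers ℚ) 3) :=
  T5InertGlobalToLocal.irreducible_algebraMap_global T5InertPrimeToy.vThree 3 intValuation_three_vThree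

variable (L : Type*) [Field L] [CharZero L] [IsCyclotomicExtension {2 ^ 2} ℚ L]

/-- The identity form on `ℚ(i)_{(3)}³` is isotropic. -/
theorem exists_isotropic_one :
    haveI : NumberField L := IsCyclotomicExtension.numberField {2 ^ 2} ℚ L
    haveI := T5InertPrimeToy.liesOver L
    ∀ (σ : (T5InertPrimeToy.wThree L).adicCompletion L ≃ₐ[T5InertPrimeToy.vThree.adicCompletion ℚ]
      (T5InertPrimeToy.wThree L).adicCompletion L) (hσ : σ ≠ 1),
    letI := T5StarOfInvolution.starRingOfQuadratic
      (T5InertGlobalPrime.finrank_adicCompletion_eq_two_of_staysPrime T5InertPrimeToy.vThree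
        (T5InertPrimeToy.wThree L) (T5InertPrimeToy.finrank_eq_two L) (T5InertPrimeToy.map_eq L))
      σ hσ
    ∃ x : Fin 3 → (T5InertPrimeToy.wThree L).adicCompletion L, x ≠ 0 ∧
      T5UnitaryGroupIsometry.sesqForm
        (1 : Matrix (Fin 3) (Fin 3) ((T5InertPrimeToy.wThree L).adicCompletion L)) x x = 0 := by
  haveI : NumberField L := IsCyclotomicExtension.numberField {2 ^ 2} ℚ L
  haveI := T5InertPrimeToy.liesOver L
  intro σ hσ
  letI := T5StarOfInvolution.starRingOfQuadratic
    (T5InertGlobalPrime.finrank_adicCompletion_eq_two_of_staysPrime T5InertPrimeToy.vThree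
      (T5InertPrimeToy.wThree L) (T5InertPrimeToy.finrank_eq_two L) (T5InertPrimeToy.map_eq L))
    σ hσ
  exact T5InertPlaceGlobalPackage.exists_isotropic_of_staysPrime T5InertPrimeToy.vThree
    (T5InertPrimeToy.wThree L) (T5InertPrimeToy.finrank_eq_two L) (T5InertPrimeToy.map_eq L)
    irreducible_three_vThree σ hσ Matrix.isHermitian_one (by rw [Matrix.det_one]; exact isUnit_one)

/-- The entries of the identity matrix are integral. -/
theorem isInteger_one_apply {R S : Type*} [CommRing R] [CommRing S] [Algebra R S] (i j : Fin 3) :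
    IsLocalization.IsInteger R ((1 : Matrix (Fin 3) (Fin 3) S) i j) := by
  rw [Matrix.one_apply]
  split_ifs
  · exact IsLocalization.isInteger_one
  · exact IsLocalization.isInteger_zero

/-- THE SPHERICAL HECKE ALGEBRA OF THE UNITARY GROUP OF THE IDENTITY FORM OVER `ℚ(i)_{(3)}`, with
respect to its integral points, IS COMMUTATIVE — every hypothesis of the inert-place package
discharged on a concrete instance. -/
theorem heckeAlgebra_mul_comm_one (k : Type*) [Field k] :
    haveI : NumberField L := IsCyclotomicExtension.numberField {2 ^ 2} ℚ L
    haveI := T5InertPrimeToy.liesOver L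
    ∀ (σ : (T5InertPrimeToy.wThree L).adicCompletion L ≃ₐ[T5InertPrimeToy.vThree.adicCompletion ℚ]
      (T5InertPrimeToy.wThree L).adicCompletion L) (hσ : σ ≠ 1),
    letI := T5StarOfInvolution.starRingOfQuadratic
      (T5InertGlobalPrime.finrank_adicCompletion_eq_two_of_staysPrime T5InertPrimeToy.vThree
        (T5InertPrimeToy.wThree L) (T5InertPrimeToy.finrank_eq_two L) (T5InertPrimeToy.map_eq L))
      σ hσ
    ∀ (T S : T5HeckePermutationModule.heckeAlgebra k (T5UnitaryHeckeAdjoint.hyperspecialSubgroup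
      (integralClosure (T5InertPrimeToy.vThree.adicCompletionIntegers ℚ)
        ((T5InertPrimeToy.wThree L).adicCompletion L))
        (1 : Matrix (Fin 3) (Fin 3) ((T5InertPrimeToy.wThree L).adicCompletion L)))),
      T * S = S * T := by
  haveI : NumberField L := IsCyclotomicExtension.numberField {2 ^ 2} ℚ L
  haveI := T5InertPrimeToy.liesOver L
  intro σ hσ T S
  letI := T5StarOfInvolution.starRingOfQuadratic
    (T5InertGlobalPrime.finrank_adicCompletion_eq_two_of_staysPrime T5InertPrimeToy.vThree
      (T5InertPrimeToy.wThree L) (T5InertPrimeToy.finrank_eq_two L) (T5InertPrimeToy.map_eq L))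
    σ hσ
  letI : Algebra (integralClosure (T5InertPrimeToy.vThree.adicCompletionIntegers ℚ)
      ((T5InertPrimeToy.wThree L).adicCompletion L)) ((T5InertPrimeToy.wThree L).adicCompletion L) :=
    Subalgebra.toAlgebra _
  have hint : ∀ i j, IsLocalization.IsInteger
      (integralClosure (T5InertPrimeToy.vThree.adicCompletionIntegers ℚ)
        ((T5InertPrimeToy.wThree L).adicCompletion L))
      ((1 : Matrix (Fin 3) (Fin 3) ((T5InertPrimeToy.wThree L).adicCompletion L)) i j) :=
    fun i j => isInteger_one_apply i j
  exact T5InertPlaceGlobalPackage.heckeAlgebra_mul_comm_of_staysPrime T5InertPrimeToy.vThree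
    (T5InertPrimeToy.wThree L) (T5InertPrimeToy.finrank_eq_two L) (T5InertPrimeToy.map_eq L)
    irreducible_three_vThree σ hσ 1 k Matrix.isHermitian_one hint
    (by rw [Matrix.det_one]; exact isUnit_one) (by rw [inv_one]; exact hint) T S

/-- `(ℚ(i)_{(3)}³, 1)` admits a self-dual `𝒪_{E_v}`-lattice: `det 1 = 1 = 1 · 3^{2·0}`. -/
theorem exists_dualLattice_eq_one :
    haveI : NumberField L := IsCyclotomicExtension.numberField {2 ^ 2} ℚ L
    haveI := T5InertPrimeToy.liesOver L
    ∀ (σ : (T5InertPrimeToy.wThree L).adicCompletion L ≃ₐ[T5InertPrimeToy.vThree.adicCompletion ℚ]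
      (T5InertPrimeToy.wThree L).adicCompletion L) (hσ : σ ≠ 1),
    letI := T5StarOfInvolution.starRingOfQuadratic
      (T5InertGlobalPrime.finrank_adicCompletion_eq_two_of_staysPrime T5InertPrimeToy.vThree
        (T5InertPrimeToy.wThree L) (T5InertPrimeToy.finrank_eq_two L) (T5InertPrimeToy.map_eq L))
      σ hσ
    ∃ Q : Matrix (Fin 3) (Fin 3) ((T5InertPrimeToy.wThree L).adicCompletion L), IsUnit Q ∧
      T5UnitaryGroupIsometry.dualLattice
        (integralClosure (T5InertPrimeToy.vThree.adicCompletionIntegers ℚ)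
          ((T5InertPrimeToy.wThree L).adicCompletion L))
        (Q.conjTranspose * 1 * Q)
        (T5UnitaryGroupIsometry.stdLattice
          (integralClosure (T5InertPrimeToy.vThree.adicCompletionIntegers ℚ)
            ((T5InertPrimeToy.wThree L).adicCompletion L))) =
      T5UnitaryGroupIsometry.stdLattice
        (integralClosure (T5InertPrimeToy.vThree.adicCompletionIntegers ℚ)
          ((T5InertPrimeToy.wThree L).adicCompletion L)) := by
  haveI : NumberField L := IsCyclotomicExtension.numberField {2 ^ 2} ℚ L
  haveI := T5InertPrimeToy.liesOver L
  intro σ hσ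
  letI := T5StarOfInvolution.starRingOfQuadratic
    (T5InertGlobalPrime.finrank_adicCompletion_eq_two_of_staysPrime T5InertPrimeToy.vThree
      (T5InertPrimeToy.wThree L) (T5InertPrimeToy.finrank_eq_two L) (T5InertPrimeToy.map_eq L))
    σ hσ
  refine (T5InertPlaceGlobalPackage.exists_dualLattice_eq_iff_of_staysPrime T5InertPrimeToy.vThree
    (T5InertPrimeToy.wThree L) (T5InertPrimeToy.finrank_eq_two L) (T5InertPrimeToy.map_eq L)
    irreducible_three_vThree σ hσ Matrix.isHermitian_one (by rw [Matrix.det_one]; exact isUnit_one)).2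
    ⟨1, 0, ?_⟩
  simp

end Summit.Ventures.HodgeRepro2.T5InertToyHeckeCommutative
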